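import Summits.QuantumFields.BalabanUV.T4Continuum.Support.NE9KernelGeometryLattice
import Summits.QuantumFields.BalabanUV.T4Continuum.Support.NE9LatticeExpSums
import Summits.QuantumFields.BalabanUV.T4Continuum.Support.B13Carriers
import Literature.MathematicalPhysics.QuantumFieldTheory.Balaban1983to89.B12Decay510Torus

/-!
# NE9KernelGeometryTorus — the kernel species' geometry binder (G) AND its two lattice sums (S) on the TORUS model:
# periodic ℓ¹ distance `pl1`, printed linear size `torusTreeLen`, print's cube-sum constant `K₁`
# (cell `pub-balaban`, T4-DAG §2 node U3 / §6 NE9; swarm unit b2b-balaban-t4-ne9-formalise-leaf-09, generation 7; own-initiative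
# micro-item «(G)(S)-TORUS», journal CLAIM l.11463 — sequel of «(G)-GEOM» p214491 / «(G)-REC» p215343 and the torus twin of
# crew row (w24) `NE9LatticeExpSums` p214386)

HONEST FRAMING (T4-DAG PAGE 1).  Rung (B)+1 of the FINITE-VOLUME T⁴ programme — NOT infinite volume, NOT a mass gap, NOT the
Clay problem.  NE9 (`T4OutputRate.NE9` ∧ `FadingMemory`) is a cell NEW ESTIMATE, NOT PRINTED, NOT discharged here («NE9 ⇐ the
named binders»); spine 0/9; 0/18 skeleton leaves instantiated on Bałaban's objects (O-NE9-1).  HONEST DEPENDENCY (cell line,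
verbatim): continuum YM on T⁴ ⇐ BetaPertH ∧ nine spine estimates (0/9 proved); BetaPertH ⇐ (D1) ∧ (D4) ∧ CAP+tail; G-an2-4
gates asym, D1 and NE2/3/4.  `FlowStep.BetaPertH`, (B), (B^μ) do not occur.  [I] = [Balaban1987RG1] (CMP **109**) is quoted for
TYPES only (ABSOLUTE RULE: nothing printed in the audited series is asserted).

WHERE THIS SITS.  The row owner's kernel species `NE9Lemma1KernelSpecies.KerData` ([I] §4's point-localized terms; skeleton
v1.3.6 ADDENDUM) carries the point set, the ξ-distances `ρd : Pt → Pt → ℝ`, `dX : Dom → Pt → ℝ` and the base points `p0` as DATA,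
and displays inside `KerData.Admissible` the binders
  (G)  `δ₁·ρd (p0 X) p + δ₁·ρd p q ≤ δ₀·(dX X p + dX X q) + w·d(X) + w₀`          ([I] p. 286, «δ₁ = O(M⁻¹)»),
  (S)  `Σ_{p∈pts} e^{−δ₁·ρd (p0 X) p} ≤ c₀`,  `Σ_{q∈pts} (ρd p q)^m·e^{−δ₁·ρd p q} ≤ c₁`   (print's c₀(δ₁), c₁(δ₁)).
So far the tree discharges them on the UNIVERSAL COVER only: (G) for a Mathlib `PseudoMetricSpace` (`NE9KernelGeometry`, with
`dX := infDist`) and on the window lattice ℤ^d (`NE9KernelGeometryLattice.geom_lattice`), (S) on finite families of ℤ^d in the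
sup metric (`NE9LatticeExpSums`).  The cell's carriers of record (`B13Carriers.TwoRuns.carriers`) are TORUS domains
(`TreeLengthTorus.TDom`, `d := torusTreeLen`, located finding F-ne9leaf07g5-1), whose sites `TPt d (N·M) = (ℤ/NM)^d` carry the
periodic ℓ¹ distance `B12Decay510Torus.pl1 (p − q)` — NOT a Mathlib `dist` (no metric instance on `ZMod`), which is why
`NE9KernelGeometryLattice` left the torus reading as a remark.  THIS FILE does the torus reading:

* §1 (G) FOR PSEUDO-DISTANCE DATA: (G)-GEOM's triangle-inequality argument re-typed ONCE for any symmetric `ρ` satisfying the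
  triangle inequality and any nonnegative `dS` that is ATTAINED FROM BELOW (`∀ p, ∃ u ∈ S, ρ p u ≤ dS p`) — `geomRho_of_extent`,
  `geomRho_letters` (δ₁ := min (δ₀/2) (w/(2cM)), w₀ := w; the letter lemmas of `NE9KernelGeometry` BY NAME) and the family form
  `geomRho_family_letters` token-shaped like `KerData.Admissible.geom` (the shape in which `KerData` actually consumes (G));
* §2 (G) ON THE TORUS: `Pt := TPt d (N·M)`, `ρd p q := pl1 (p − q)`, `dX X̄ p := X̄.inf' _ (distCT N M p)` (= dist^{(ξ)}(X̄, p) in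
  lattice units: the least periodic distance from `p` to a site of a cube of `X̄`, attained by `exists_distCT_eq`), base point any
  site of a cube of `X̄`, `d := torusTreeLen X̄`, extent `M·d·(torusTreeLen X̄ + 3)` by b03's `pl1_sub_le_torusTreeLen_sites`:
  **`geom_torus`** with the SAME letters as `geom_lattice`, `δ₁ := min (δ₀/2) (w/(2·(3·M·d)))`, `w₀ := w` (positivity and
  `δ₁ ≤ w/(6Md)` = `NE9KernelGeometryLattice.delta1_lattice_pos_le`, not restated), and the per-catalogue family form
  `geom_torus_family` over `TDom d N` (base sites exist: `exists_base_site`);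
* §3 (S) ON THE TORUS, for ANY finite point family `S ⊆ (ℤ/T)^d` and base point: **`sum_exp_neg_pl1_le_K₁`**
  `Σ_{p∈S} e^{−δ·pl1(p₀ − p)} ≤ K₁ d δ` (print's own cube-sum constant K₁ of (5.10), b03's `sum_exp_pl1_le_K₁` + a translation of
  the torus) and **`sum_pow_mul_exp_neg_pl1_le`** `Σ_{q∈S} pl1(p − q)^m·e^{−δ·pl1(p − q)} ≤ (2m/(eδ))^m·K₁ d (δ/2)` ((w24)'s split
  `t^m e^{−δt} ≤ (2m/(eδ))^m e^{−δt/2}`, `pow_mul_exp_neg_le` BY NAME); family forms `sum0_torus_family` / `sum1_torus_family`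
  token-shaped like `KerData.Admissible.sum0` / `sum1`; and **`K₁_le_c0`**: print's `K₁ d δ ≤ (2/(1 − e^{−δ/d}))^d` = (w24)'s
  explicit c₀(δ,d) (sup ≤ ℓ¹ on ℤ^d, b03's `dist_le_l1`, and `sum_exp_neg_dist_le` under the `tsum`);
* §5 READ-OUT AT THE CARRIERS OF RECORD (`d = 4`): `geom_carriersOfRecord` — (G) at `X : R.carriers.Dom` on the sites
  `(ℤ/(N_j·M))⁴` of its scale with the carrier's own `R.carriers.d X` (`carriers_d`, rfl) — and `sums_carriersOfRecord`.

WHAT IS NOT CLAIMED.  The point TYPE of the carriers of record (ONE `Pt` hosting every unit lattice `T₁^{(j)}`, j the creation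
scale — a sigma over scales) and the ξ-unit rescaling are O-NE9-1's (carver); this module types ONE catalogue `TDom d N` / one
fine torus `TPt d (N·M)`.  (K), the level counts at κ − w, and NE9 itself are untouched; nothing printed is asserted.
DISGUISE TEST: metric bookkeeping and two exponential sums on a finite torus; no term, no activity, no history — not NE9.

References (TYPES only): [Balaban1987RG1] T. Bałaban, *Renormalization group approach to lattice gauge field theories. I*,
Commun. Math. Phys. **109** (1987) 249–301: (0.1) p. 251 (the torus), p. 257 (π_j, d_j(X)), (4.21)–(4.22) pp. 285–286 and the
display after (4.22) («δ₁ = O(M⁻¹)», c₀(δ₁), c₁(δ₁)), (5.10) p. 293 (K₁).  Summits-side NEW work (LEAN PLACEMENT RULE); imports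
`NE9KernelGeometryLattice` (p215343; transitively `NE9KernelGeometry` p214491, `B12Cubes436`), `NE9LatticeExpSums` (p214386),
`B13Carriers` (the carriers of record, §5 read-out) and the Literature module `B12Decay510Torus` (b03) BY NAME; modifies nothing;
0 sorry; 0 def.
Value = three displayed binders of species (b) discharged on the torus model with explicit letters, NOT summit progress.
-/

noncomputable section

namespace Summit.QuantumFields.BalabanUV.T4Continuum.NE9KernelGeometryTorus

open scoped BigOperators
open Metric Set
open Literature.MathematicalPhysics.QuantumFieldTheory.Balaban1983to89
open Literature.MathematicalPhysics.QuantumFieldTheory.Balaban1983to89.TreeLengthTorus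
  (TPt TFaceConnected TDom torusTreeLen torusTreeLen_nonneg)
open Literature.MathematicalPhysics.QuantumFieldTheory.Balaban1983to89.B12Decay510Torus
  (vmaVec pl1 pl1_nonneg pl1_sub_comm pl1_sub_triangle tcubeOf base tcubeOf_base distCT distCT_le exists_distCT_eq
    distCT_nonneg pl1_sub_le_torusTreeLen_sites sum_exp_pl1_le_K₁)
open Literature.MathematicalPhysics.QuantumFieldTheory.Balaban1983to89.B12Decay510Window (K₁ K₁_nonneg)
open Literature.MathematicalPhysics.QuantumFieldTheory.Balaban1983to89.B12Cubes436 (dist_le_l1)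
open Literature.MathematicalPhysics.QuantumFieldTheory.Balaban1983to89.B12Sec2to5 (l1 summable_exp_neg_l1)
open Summit.QuantumFields.BalabanUV.T4Continuum.NE9KernelGeometry (delta1_nonneg two_mul_delta1_le two_mul_delta1_mul_le)
open Summit.QuantumFields.BalabanUV.T4Continuum.NE9LatticeExpSums (pow_mul_exp_neg_le sum_exp_neg_dist_le)

/-! ## §1 (G) for pseudo-distance DATA (`ρ` symmetric with the triangle inequality, `dS` attained from below) -/

section Rho

variable {Pt : Type*} (ρ : Pt → Pt → ℝ)

/-- A base point `x₀` of the site set `S` is within `dS p + Δ` of every point `p`, `Δ` the `ρ`-extent of `S`, as soon as some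
site of `S` is within `dS p` of `p` (triangle inequality through that site). [folklore] -/
theorem rho_base_le_add (hsymm : ∀ p q, ρ p q = ρ q p) (htri : ∀ p q r, ρ p r ≤ ρ p q + ρ q r)
    {S : Set Pt} {x₀ : Pt} {Δ : ℝ} (hx₀ : x₀ ∈ S) (hΔ : ∀ u ∈ S, ∀ v ∈ S, ρ u v ≤ Δ)
    {dS : Pt → ℝ} (hdS : ∀ p, ∃ u ∈ S, ρ p u ≤ dS p) (p : Pt) : ρ x₀ p ≤ dS p + Δ := by
  obtain ⟨u, hu, hpu⟩ := hdS p
  have h1 := htri x₀ u p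
  have h2 := hΔ x₀ hx₀ u hu
  rw [hsymm u p] at h1
  linarith

/-- Two points are within `dS p + dS q + Δ` of each other (triangle inequality through the two near sites). [folklore] -/
theorem rho_le_add_add (hsymm : ∀ p q, ρ p q = ρ q p) (htri : ∀ p q r, ρ p r ≤ ρ p q + ρ q r)
    {S : Set Pt} {Δ : ℝ} (hΔ : ∀ u ∈ S, ∀ v ∈ S, ρ u v ≤ Δ)
    {dS : Pt → ℝ} (hdS : ∀ p, ∃ u ∈ S, ρ p u ≤ dS p) (p q : Pt) : ρ p q ≤ dS p + dS q + Δ := by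
  obtain ⟨u, hu, hpu⟩ := hdS p
  obtain ⟨v, hv, hqv⟩ := hdS q
  have h1 := htri p u q
  have h2 := htri u v q
  have h3 := hΔ u hu v hv
  rw [hsymm q v] at hqv
  linarith

/-- **(G) FROM THE TRIANGLE INEQUALITY, FOR DISTANCE DATA** (one source domain): `ρ` symmetric with the triangle inequality,
the site set `S ∋ x₀` of `ρ`-extent `≤ Δ`, `dS ≥ 0` attained from below on `S`, `0 ≤ δ₁`, `2δ₁ ≤ δ₀`, `2δ₁Δ ≤ w·d + w₀`; then
for all points `p, q`: `δ₁·ρ x₀ p + δ₁·ρ p q ≤ δ₀·(dS p + dS q) + w·d + w₀` — the shape of the kernel species' binder (G)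
read off [I] p. 286 (TYPE only). [cite: Balaban1987RG1, (4.22) p.286] -/
theorem geomRho_of_extent (hsymm : ∀ p q, ρ p q = ρ q p) (htri : ∀ p q r, ρ p r ≤ ρ p q + ρ q r)
    {S : Set Pt} {x₀ : Pt} {Δ δ₀ δ₁ w w₀ d : ℝ} (hx₀ : x₀ ∈ S) (hΔ : ∀ u ∈ S, ∀ v ∈ S, ρ u v ≤ Δ)
    {dS : Pt → ℝ} (hdS : ∀ p, ∃ u ∈ S, ρ p u ≤ dS p) (hdS0 : ∀ p, 0 ≤ dS p)
    (hδ₁ : 0 ≤ δ₁) (hδ : 2 * δ₁ ≤ δ₀) (hw : 2 * δ₁ * Δ ≤ w * d + w₀) (p q : Pt) :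
    δ₁ * ρ x₀ p + δ₁ * ρ p q ≤ δ₀ * (dS p + dS q) + w * d + w₀ := by
  have h1 : δ₁ * ρ x₀ p ≤ δ₁ * (dS p + Δ) :=
    mul_le_mul_of_nonneg_left (rho_base_le_add ρ hsymm htri hx₀ hΔ hdS p) hδ₁
  have h2 : δ₁ * ρ p q ≤ δ₁ * (dS p + dS q + Δ) :=
    mul_le_mul_of_nonneg_left (rho_le_add_add ρ hsymm htri hΔ hdS p q) hδ₁
  have hp := hdS0 p
  have hq := hdS0 q
  have h3 : 2 * δ₁ * dS p ≤ δ₀ * dS p := mul_le_mul_of_nonneg_right hδ hp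
  have h4 : δ₁ * dS q ≤ δ₀ * dS q := mul_le_mul_of_nonneg_right (by linarith) hq
  have e1 : δ₁ * (dS p + Δ) = δ₁ * dS p + δ₁ * Δ := by ring
  have e2 : δ₁ * (dS p + dS q + Δ) = δ₁ * dS p + δ₁ * dS q + δ₁ * Δ := by ring
  have e3 : δ₀ * (dS p + dS q) = δ₀ * dS p + δ₀ * dS q := by ring
  have e4 : 2 * δ₁ * Δ = δ₁ * Δ + δ₁ * Δ := by ring
  have e5 : 2 * δ₁ * dS p = δ₁ * dS p + δ₁ * dS p := by ring
  linarith

/-- **(G) FOR DISTANCE DATA WITH PRINT'S LETTERS MADE EXACT**: extent `Δ ≤ cM·(d + 1)` (`d ≥ 0`, `cM > 0`), decay letters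
`δ₀ ≥ 0`, `w ≥ 0`; then (G) holds with `δ₁ := min (δ₀/2) (w/(2cM))` and `w₀ := w` («δ₁ = O(M⁻¹)» of [I] p. 286 as
`δ₁ ≤ w/(2cM)`; the letter lemmas are `NE9KernelGeometry`'s). [cite: Balaban1987RG1, (4.22) p.286] -/
theorem geomRho_letters (hsymm : ∀ p q, ρ p q = ρ q p) (htri : ∀ p q r, ρ p r ≤ ρ p q + ρ q r)
    {S : Set Pt} {x₀ : Pt} {Δ δ₀ w cM d : ℝ} (hx₀ : x₀ ∈ S) (hΔS : ∀ u ∈ S, ∀ v ∈ S, ρ u v ≤ Δ)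
    {dS : Pt → ℝ} (hdS : ∀ p, ∃ u ∈ S, ρ p u ≤ dS p) (hdS0 : ∀ p, 0 ≤ dS p)
    (hδ₀ : 0 ≤ δ₀) (hw : 0 ≤ w) (hcM : 0 < cM) (hd : 0 ≤ d) (hΔ : Δ ≤ cM * (d + 1)) (p q : Pt) :
    min (δ₀ / 2) (w / (2 * cM)) * ρ x₀ p + min (δ₀ / 2) (w / (2 * cM)) * ρ p q ≤
      δ₀ * (dS p + dS q) + w * d + w :=
  geomRho_of_extent ρ hsymm htri hx₀ hΔS hdS hdS0 (delta1_nonneg hδ₀ hw hcM) (two_mul_delta1_le δ₀ w cM)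
    (two_mul_delta1_mul_le hδ₀ hw hcM hd hΔ) p q

/-- **THE FAMILY FORM, token-shaped like `KerData.Admissible.geom`** (`ρd`, `dX`, `p0` as data; domains `x.1` of `x : Dom × τ`):
site sets `S X ∋ p0 X` of `ρd`-extent `Δ X ≤ cM·(d X + 1)`, `dX X` nonnegative and attained from below on `S X`; then (G) holds
for the whole family with `δ₁ := min (δ₀/2) (w/(2cM))`, `w₀ := w`. [cite: Balaban1987RG1, (4.22) p.286] -/
theorem geomRho_family_letters {Dom ι α τ : Type*} (pts : ℕ → ι → α → Finset Pt) (ρd : Pt → Pt → ℝ)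
    (hsymm : ∀ p q, ρd p q = ρd q p) (htri : ∀ p q r, ρd p r ≤ ρd p q + ρd q r)
    (S : Dom → Set Pt) (p0 : Dom → Pt) (dX : Dom → Pt → ℝ) (d Δ : Dom → ℝ) {δ₀ w cM : ℝ}
    (hp0 : ∀ X, p0 X ∈ S X) (hΔS : ∀ X, ∀ u ∈ S X, ∀ v ∈ S X, ρd u v ≤ Δ X)
    (hdX : ∀ X p, ∃ u ∈ S X, ρd p u ≤ dX X p) (hdX0 : ∀ X p, 0 ≤ dX X p)
    (hδ₀ : 0 ≤ δ₀) (hw : 0 ≤ w) (hcM : 0 < cM) (hd : ∀ X, 0 ≤ d X) (hΔ : ∀ X, Δ X ≤ cM * (d X + 1)) :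
    ∀ (k : ℕ) (y : ι) (a : α) (x : Dom × τ), ∀ p ∈ pts k y a, ∀ q ∈ pts k y a,
      min (δ₀ / 2) (w / (2 * cM)) * ρd (p0 x.1) p + min (δ₀ / 2) (w / (2 * cM)) * ρd p q ≤
        δ₀ * (dX x.1 p + dX x.1 q) + w * d x.1 + w :=
  fun _ _ _ x p _ q _ =>
    geomRho_letters ρd hsymm htri (hp0 x.1) (hΔS x.1) (hdX x.1) (hdX0 x.1) hδ₀ hw hcM (hd x.1) (hΔ x.1) p q

end Rho

/-! ## §2 (G) on the torus: sites `(ℤ/NM)^d`, cubes `(ℤ/N)^d`, periodic ℓ¹ distance, `torusTreeLen` -/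

section Torus

variable {d N M : ℕ} [NeZero N] [NeZero M]

/-- **dist^{(ξ)}(X̄, p) IS ATTAINED**: for a nonempty family `X̄` of cubes of the torus and a site `p`, some site `u` of a cube of
`X̄` has `pl1 (p − u) ≤ min_{□ ∈ X̄} dist(p, □)` (`distCT` is itself a minimum over the sites of the cube). [folklore] -/
theorem exists_site_pl1_le_inf {X : Finset (TPt d N)} (hX : X.Nonempty) (p : TPt d (N * M)) :
    ∃ u ∈ {u : TPt d (N * M) | tcubeOf N M u ∈ X}, pl1 (p - u) ≤ X.inf' hX (distCT N M p) := by
  obtain ⟨c, hc, hce⟩ := Finset.exists_mem_eq_inf' hX (distCT N M p)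
  obtain ⟨u, hu, hue⟩ := exists_distCT_eq p c
  refine ⟨u, ?_, le_of_eq (hue.trans hce.symm)⟩
  show tcubeOf N M u ∈ X
  rw [hu]
  exact hc

/-- `min_{□ ∈ X̄} dist(p, □) ≥ 0`. [folklore] -/
theorem inf_distCT_nonneg {X : Finset (TPt d N)} (hX : X.Nonempty) (p : TPt d (N * M)) :
    0 ≤ X.inf' hX (distCT N M p) :=
  Finset.le_inf' hX _ fun c _ => distCT_nonneg p c

/-- `min_{□ ∈ X̄} dist(p, □) ≤ pl1 (p − u)` for every site `u` of a cube of `X̄`. [folklore] -/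
theorem inf_distCT_le_pl1 {X : Finset (TPt d N)} (hX : X.Nonempty) (p : TPt d (N * M)) {u : TPt d (N * M)}
    (hu : tcubeOf N M u ∈ X) : X.inf' hX (distCT N M p) ≤ pl1 (p - u) :=
  (Finset.inf'_le _ hu).trans (distCT_le rfl)

/-- The site-level extent of a torus localization domain in the shape of the diameter letter: `pl1 (p − q) ≤ 3·M·d·(torusTreeLen
X̄ + 1)` for sites `p, q` of cubes of a face-connected nonempty `X̄` (b03's `pl1_sub_le_torusTreeLen_sites`: `≤ M·d·(torusTreeLen
X̄ + 3)`, and `torusTreeLen ≥ 0`). [folklore] -/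
theorem extent_tsites_le_letter {X : Finset (TPt d N)} (hX : X.Nonempty) (hc : TFaceConnected X) {p q : TPt d (N * M)}
    (hp : tcubeOf N M p ∈ X) (hq : tcubeOf N M q ∈ X) : pl1 (p - q) ≤ 3 * (M : ℝ) * d * (torusTreeLen X + 1) := by
  have h := pl1_sub_le_torusTreeLen_sites hX hc hp hq
  have ht : 0 ≤ torusTreeLen X := torusTreeLen_nonneg X
  have hMd : 0 ≤ (M : ℝ) * d := by positivity
  nlinarith [mul_nonneg hMd ht]

/-- **(G) FOR THE KERNEL SPECIES ON THE TORUS MODEL**: for a face-connected nonempty family `X̄` of cubes of `(ℤ/N)^d`, a base site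
`x₀` of one of its cubes (in `(ℤ/NM)^d`), decay letters `δ₀ ≥ 0`, `w ≥ 0`, and `0 < d`, the binder (G) of `KerData.Admissible`
holds for ALL sites `p, q` with `ρd p q := pl1 (p − q)` (periodic ℓ¹), `dX X̄ p := min_{□ ∈ X̄} dist(p, □)`, `d(X̄) := torusTreeLen
X̄`, **`δ₁ := min (δ₀/2) (w/(2·(3·M·d)))`** and **`w₀ := w`**:
`δ₁·pl1 (x₀ − p) + δ₁·pl1 (p − q) ≤ δ₀·(dX X̄ p + dX X̄ q) + w·torusTreeLen X̄ + w`.  Print: *"δ₁ = O(M⁻¹), because of the factor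
with κd_j(X)"* ([I] p. 286; here `δ₁ ≤ w/(6Md)`, `NE9KernelGeometryLattice.delta1_lattice_pos_le`).
[cite: Balaban1987RG1, (4.22) p.286] -/
theorem geom_torus (hd : 0 < d) {X : Finset (TPt d N)} (hX : X.Nonempty) (hc : TFaceConnected X) {x₀ : TPt d (N * M)}
    (hx₀ : tcubeOf N M x₀ ∈ X) {δ₀ w : ℝ} (hδ₀ : 0 ≤ δ₀) (hw : 0 ≤ w) (p q : TPt d (N * M)) :
    min (δ₀ / 2) (w / (2 * (3 * (M : ℝ) * d))) * pl1 (x₀ - p) + min (δ₀ / 2) (w / (2 * (3 * (M : ℝ) * d))) * pl1 (p - q) ≤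
      δ₀ * (X.inf' hX (distCT N M p) + X.inf' hX (distCT N M q)) + w * torusTreeLen X + w := by
  have hM : (0 : ℝ) < M := by exact_mod_cast Nat.pos_of_neZero M
  have hcM : (0 : ℝ) < 3 * (M : ℝ) * d := by positivity
  have ht : 0 ≤ torusTreeLen X := torusTreeLen_nonneg X
  have hMd : 0 ≤ (M : ℝ) * d := by positivity
  have hΔ : (M : ℝ) * d * (torusTreeLen X + 3) ≤ 3 * (M : ℝ) * d * (torusTreeLen X + 1) := by
    nlinarith [mul_nonneg hMd ht]
  exact geomRho_letters (fun p q : TPt d (N * M) => pl1 (p - q)) (fun p q => pl1_sub_comm p q)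
    (fun p q r => pl1_sub_triangle p q r) (S := {u : TPt d (N * M) | tcubeOf N M u ∈ X}) hx₀
    (fun _ hu _ hv => pl1_sub_le_torusTreeLen_sites hX hc hu hv) (dS := fun p => X.inf' hX (distCT N M p))
    (fun p => exists_site_pl1_le_inf hX p) (fun p => inf_distCT_nonneg hX p) hδ₀ hw hcM ht hΔ p q

/-- Every torus localization domain has a base site: the corner site of any of its cubes. [folklore] -/
theorem exists_base_site (X : TDom d N) : ∃ x₀ : TPt d (N * M), tcubeOf N M x₀ ∈ X.1 := by
  obtain ⟨c, hc⟩ := X.2.1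
  exact ⟨base N M c, by rw [tcubeOf_base]; exact hc⟩

/-- **THE PER-CATALOGUE FAMILY FORM ON THE TORUS**, token-shaped like `KerData.Admissible.geom` restricted to one catalogue
`𝐃 = TDom d N` (domains `x.1` of `x : TDom d N × τ`, base sites `x0 X` in a cube of `X`, any index families `pts`): (G) with
`ρd p q := pl1 (p − q)`, `dX X p := min_{□ ∈ X} dist(p, □)`, `d X := torusTreeLen X`, `δ₁ := min (δ₀/2) (w/(2·(3·M·d)))`, `w₀ := w`.
The sigma over creation scales of the carriers of record (one point type for all `T₁^{(j)}`) is O-NE9-1's transcription.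
[cite: Balaban1987RG1, (4.22) p.286] -/
theorem geom_torus_family (hd : 0 < d) {ι α τ : Type*} (pts : ℕ → ι → α → Finset (TPt d (N * M)))
    (x0 : TDom d N → TPt d (N * M)) (hx0 : ∀ X, tcubeOf N M (x0 X) ∈ X.1) {δ₀ w : ℝ} (hδ₀ : 0 ≤ δ₀) (hw : 0 ≤ w) :
    ∀ (k : ℕ) (y : ι) (a : α) (x : TDom d N × τ), ∀ p ∈ pts k y a, ∀ q ∈ pts k y a,
      min (δ₀ / 2) (w / (2 * (3 * (M : ℝ) * d))) * pl1 (x0 x.1 - p) +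
          min (δ₀ / 2) (w / (2 * (3 * (M : ℝ) * d))) * pl1 (p - q) ≤
        δ₀ * (x.1.1.inf' x.1.2.1 (distCT N M p) + x.1.1.inf' x.1.2.1 (distCT N M q)) + w * torusTreeLen x.1.1 + w :=
  fun _ _ _ x p _ q _ => geom_torus hd x.1.2.1 x.1.2.2 (hx0 x.1) hδ₀ hw p q

end Torus

/-! ## §3 (S) on the torus: the two exponential sums with print's constant `K₁` -/

section Sums

variable {d T : ℕ} [NeZero T]

/-- **THE LATTICE SUM `sum0` ON THE TORUS**: for `δ > 0`, EVERY finite family `S` of sites of `(ℤ/T)^d` and every base point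
`p₀`: `Σ_{p ∈ S} e^{−δ·pl1(p₀ − p)} ≤ K₁ d δ` (enlarge to the whole torus, translate by `p₀`, and b03's `sum_exp_pl1_le_K₁`:
the minimal representatives embed `(ℤ/T)^d` into ℤ^d isometrically for |·|₁).  Print: [I] p. 286, the sum over x of
exp(−δ₁|x − x₀|), constant c₀(δ₁); K₁ is the cube-sum constant of (5.10). [cite: Balaban1987RG1, (4.21)-(4.22) pp.285-286] -/
theorem sum_exp_neg_pl1_le_K₁ {δ : ℝ} (hδ : 0 < δ) (S : Finset (TPt d T)) (p₀ : TPt d T) :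
    ∑ p ∈ S, Real.exp (-(δ * pl1 (p₀ - p))) ≤ K₁ d δ := by
  classical
  calc ∑ p ∈ S, Real.exp (-(δ * pl1 (p₀ - p)))
      ≤ ∑ p, Real.exp (-(δ * pl1 (p₀ - p))) :=
        Finset.sum_le_univ_sum_of_nonneg fun p => (Real.exp_pos _).le
    _ = ∑ w : TPt d T, Real.exp (-δ * pl1 w) := by
        refine Fintype.sum_equiv (Equiv.subLeft p₀) _ _ fun p => ?_
        show Real.exp (-(δ * pl1 (p₀ - p))) = Real.exp (-δ * pl1 (p₀ - p))
        rw [neg_mul]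
    _ ≤ K₁ d δ := sum_exp_pl1_le_K₁ hδ

/-- **THE LATTICE SUM `sum1` ON THE TORUS**: for `δ > 0`, `m : ℕ`, EVERY finite family `S` of sites of `(ℤ/T)^d` and every site
`p`: `Σ_{q ∈ S} pl1(p − q)^m·e^{−δ·pl1(p − q)} ≤ (2m/(eδ))^m · K₁ d (δ/2)` ((w24)'s split `t^m e^{−δt} ≤ (2m/(eδ))^m e^{−δt/2}`,
then `sum0` at rate δ/2).  Print: [I] p. 286, the sum over x₃ of |x₃ − x|^m exp(−δ₁|x₃ − x|) (m = 1 for (4.21), m = 2 for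
(4.30)), constant c₁(δ₁). [cite: Balaban1987RG1, (4.21)-(4.22) pp.285-286] -/
theorem sum_pow_mul_exp_neg_pl1_le {δ : ℝ} (hδ : 0 < δ) (m : ℕ) (S : Finset (TPt d T)) (p : TPt d T) :
    ∑ q ∈ S, pl1 (p - q) ^ m * Real.exp (-(δ * pl1 (p - q))) ≤ (2 * m / (Real.exp 1 * δ)) ^ m * K₁ d (δ / 2) := by
  have hδ2 : 0 < δ / 2 := by positivity
  have hK : ∀ q, pl1 (p - q) ^ m * Real.exp (-(δ * pl1 (p - q))) ≤
      (2 * m / (Real.exp 1 * δ)) ^ m * Real.exp (-(δ / 2 * pl1 (p - q))) := by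
    intro q
    have h := pow_mul_exp_neg_le m hδ2 (pl1_nonneg (p - q))
    have hsplit : Real.exp (-(δ * pl1 (p - q))) =
        Real.exp (-(δ / 2 * pl1 (p - q))) * Real.exp (-(δ / 2 * pl1 (p - q))) := by
      rw [← Real.exp_add]; ring_nf
    have hconst : ((m : ℝ) / (δ / 2 * Real.exp 1)) ^ m = (2 * m / (Real.exp 1 * δ)) ^ m := by
      congr 1; field_simp
    rw [hsplit, ← mul_assoc, ← hconst]
    exact mul_le_mul_of_nonneg_right h (Real.exp_pos _).le
  calc ∑ q ∈ S, pl1 (p - q) ^ m * Real.exp (-(δ * pl1 (p - q)))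
      ≤ ∑ q ∈ S, (2 * m / (Real.exp 1 * δ)) ^ m * Real.exp (-(δ / 2 * pl1 (p - q))) :=
        Finset.sum_le_sum fun q _ => hK q
    _ = (2 * m / (Real.exp 1 * δ)) ^ m * ∑ q ∈ S, Real.exp (-(δ / 2 * pl1 (p - q))) := by rw [Finset.mul_sum]
    _ ≤ (2 * m / (Real.exp 1 * δ)) ^ m * K₁ d (δ / 2) :=
        mul_le_mul_of_nonneg_left (sum_exp_neg_pl1_le_K₁ hδ2 S p) (by positivity)

/-- **`sum0` IN THE FAMILY SHAPE of `KerData.Admissible.sum0`** (`ρd p q := pl1 (p − q)`, any index families and base points):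
`c₀ := K₁ d δ₁`. [cite: Balaban1987RG1, (4.21)-(4.22) pp.285-286] -/
theorem sum0_torus_family {Dom ι α : Type*} (pts : ℕ → ι → α → Finset (TPt d T)) (p0 : Dom → TPt d T) {δ₁ : ℝ}
    (hδ₁ : 0 < δ₁) :
    ∀ (k : ℕ) (y : ι) (a : α) (X : Dom), ∑ p ∈ pts k y a, Real.exp (-(δ₁ * pl1 (p0 X - p))) ≤ K₁ d δ₁ :=
  fun k y a X => sum_exp_neg_pl1_le_K₁ hδ₁ (pts k y a) (p0 X)

/-- **`sum1` IN THE FAMILY SHAPE of `KerData.Admissible.sum1`** (`ρd p q := pl1 (p − q)`, power `m`):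
`c₁ := (2m/(eδ₁))^m · K₁ d (δ₁/2)`. [cite: Balaban1987RG1, (4.21)-(4.22) pp.285-286] -/
theorem sum1_torus_family {ι α : Type*} (pts : ℕ → ι → α → Finset (TPt d T)) (m : ℕ) {δ₁ : ℝ} (hδ₁ : 0 < δ₁) :
    ∀ (k : ℕ) (y : ι) (a : α), ∀ p ∈ pts k y a,
      ∑ q ∈ pts k y a, pl1 (p - q) ^ m * Real.exp (-(δ₁ * pl1 (p - q))) ≤
        (2 * m / (Real.exp 1 * δ₁)) ^ m * K₁ d (δ₁ / 2) :=
  fun k y a p _ => sum_pow_mul_exp_neg_pl1_le hδ₁ m (pts k y a) p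

end Sums

/-! ## §4 Print's constant `K₁` against (w24)'s explicit `c₀(δ, d)` -/

/-- **`K₁ d δ ≤ (2/(1 − e^{−δ/d}))^d`** for `d ≥ 1`, `δ > 0`: print's cube-sum constant K₁(δ) = Σ_{z ∈ ℤ^d} e^{−δ|z|₁} of (5.10)
is dominated by (w24)'s explicit sup-metric constant c₀(δ,d) (sup ≤ ℓ¹ on ℤ^d, `B12Cubes436.dist_le_l1`, and
`NE9LatticeExpSums.sum_exp_neg_dist_le` under the `tsum`); so the torus letters of §3 inherit (w24)'s polynomial envelopes
(`NE9LatticeExpSums` §5). [folklore] -/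
theorem K₁_le_c0 {d : ℕ} (hd : 0 < d) {δ : ℝ} (hδ : 0 < δ) : K₁ d δ ≤ (2 / (1 - Real.exp (-(δ / d)))) ^ d := by
  unfold K₁
  refine (summable_exp_neg_l1 hδ d).tsum_le_of_sum_le fun s => ?_
  calc ∑ z ∈ s, Real.exp (-δ * l1 z) ≤ ∑ z ∈ s, Real.exp (-(δ * dist (0 : Fin d → ℤ) z)) := by
        refine Finset.sum_le_sum fun z _ => Real.exp_le_exp.2 ?_
        have h := dist_le_l1 z 0
        rw [sub_zero, dist_comm] at h
        nlinarith
    _ ≤ (2 / (1 - Real.exp (-(δ / d)))) ^ d := sum_exp_neg_dist_le hd hδ s 0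

/-- The torus `sum0` with (w24)'s EXPLICIT constant: `Σ_{p ∈ S} e^{−δ·pl1(p₀ − p)} ≤ (2/(1 − e^{−δ/d}))^d` (`d ≥ 1`).
[cite: Balaban1987RG1, (4.21)-(4.22) pp.285-286] -/
theorem sum_exp_neg_pl1_le_c0 {d T : ℕ} [NeZero T] (hd : 0 < d) {δ : ℝ} (hδ : 0 < δ) (S : Finset (TPt d T))
    (p₀ : TPt d T) : ∑ p ∈ S, Real.exp (-(δ * pl1 (p₀ - p))) ≤ (2 / (1 - Real.exp (-(δ / d)))) ^ d :=
  (sum_exp_neg_pl1_le_K₁ hδ S p₀).trans (K₁_le_c0 hd hδ)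

/-! ## §5 Read-out at a domain of the carriers of record (`B13Carriers.TwoRuns.carriers`, `d = 4`, `d X = torusTreeLen X.2.1`) -/

/-- **(G) AT A DOMAIN OF THE CARRIERS OF RECORD**: for `X : R.carriers.Dom` (a creation scale `X.1 = j` and a torus localization
domain `X.2 : TDom 4 (R.cubesPerDir j)`), a cube side `M` (in print `M = L^{m'}` sites of `T₁^{(j)}`), a base site `x₀` of a cube of
`X`, and decay letters `δ₀ ≥ 0`, `w ≥ 0`: the binder (G) on the sites `(ℤ/(N_j·M))⁴` of that scale with `ρd := pl1 (· − ·)`,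
`dX := min_{□ ∈ X} dist(·, □)`, `δ₁ := min (δ₀/2) (w/(2·(3·M·4)))`, `w₀ := w`, and the carrier's OWN size letter `R.carriers.d X`
on the right (`B13Carriers.TwoRuns.carriers_d`, rfl).  One scale at a time; the sigma over scales is O-NE9-1's.
[cite: Balaban1987RG1, (4.22) p.286] -/
theorem geom_carriersOfRecord {Gg : Type} [GaugeGroup Gg] (R : B13Carriers.TwoRuns Gg) (X : R.carriers.Dom) {M : ℕ}
    [NeZero M] {x₀ : TPt 4 (R.cubesPerDir X.1 * M)} (hx₀ : tcubeOf (R.cubesPerDir X.1) M x₀ ∈ X.2.1) {δ₀ w : ℝ}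
    (hδ₀ : 0 ≤ δ₀) (hw : 0 ≤ w) (p q : TPt 4 (R.cubesPerDir X.1 * M)) :
    min (δ₀ / 2) (w / (2 * (3 * (M : ℝ) * 4))) * pl1 (x₀ - p) + min (δ₀ / 2) (w / (2 * (3 * (M : ℝ) * 4))) * pl1 (p - q) ≤
      δ₀ * (X.2.1.inf' X.2.2.1 (distCT (R.cubesPerDir X.1) M p) + X.2.1.inf' X.2.2.1 (distCT (R.cubesPerDir X.1) M q)) +
        w * R.carriers.d X + w := by
  have h := geom_torus (d := 4) (N := R.cubesPerDir X.1) (M := M) (by norm_num) X.2.2.1 X.2.2.2 hx₀ hδ₀ hw p q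
  rw [B13Carriers.TwoRuns.carriers_d]
  norm_num at h ⊢
  exact h

/-- **(S) AT A SCALE OF THE CARRIERS OF RECORD** (`d = 4`): over any finite family of sites of `(ℤ/(N_j·M))⁴` and any base site,
`Σ_p e^{−δ₁·pl1(p₀ − p)} ≤ K₁ 4 δ₁` and `Σ_q pl1(p − q)^m·e^{−δ₁·pl1(p − q)} ≤ (2m/(eδ₁))^m·K₁ 4 (δ₁/2)`, with
`K₁ 4 δ ≤ (2/(1 − e^{−δ/4}))⁴`. [cite: Balaban1987RG1, (4.21)-(4.22) pp.285-286] -/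
theorem sums_carriersOfRecord {Gg : Type} [GaugeGroup Gg] (R : B13Carriers.TwoRuns Gg) (j M : ℕ) [NeZero M] {δ₁ : ℝ}
    (hδ₁ : 0 < δ₁) (m : ℕ) (S : Finset (TPt 4 (R.cubesPerDir j * M))) (p₀ p : TPt 4 (R.cubesPerDir j * M)) :
    ∑ p ∈ S, Real.exp (-(δ₁ * pl1 (p₀ - p))) ≤ K₁ 4 δ₁ ∧
      ∑ q ∈ S, pl1 (p - q) ^ m * Real.exp (-(δ₁ * pl1 (p - q))) ≤ (2 * m / (Real.exp 1 * δ₁)) ^ m * K₁ 4 (δ₁ / 2) ∧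
        K₁ 4 δ₁ ≤ (2 / (1 - Real.exp (-(δ₁ / 4)))) ^ 4 :=
  ⟨sum_exp_neg_pl1_le_K₁ hδ₁ S p₀, sum_pow_mul_exp_neg_pl1_le hδ₁ m S p,
    by simpa using K₁_le_c0 (d := 4) (by norm_num) hδ₁⟩

end Summit.QuantumFields.BalabanUV.T4Continuum.NE9KernelGeometryTorus

end
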